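import Summits.Ventures.PercRepro.ThetaOmega
import Summits.Ventures.PercRepro.ThetaSigmaSep

/-!
# The split of a twice-coloured family at a point: lifting and the exact credit lemma

Dossier proofs/MINE1-theoremS.md, Addendum 80 (mine-1, gen 41). Fix a point `q` of the ground
set `U`. The **projection** `projFam q F = {s \ q : s ∈ F}` is coloured by an **orientation**
`o`: a projected set takes the colours of its `q`-member when `o s = true` and of its `q`-free
member otherwise (`projColour`; `ValidOrient` says the chosen member exists). The **split**
`|G| = |π_q G| + |q-edges of G|` of `ThetaSigmaSep.lean` applied to the two families gives

* `omegaCount_proj_add_le` — **lifting**: `Ω(U \ q, π_q F) + (q-edges of A) + (q-edges of C) ≤ Ω(U, F)`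
  for every valid orientation;
* `omegaA_qEdges_subset`, `omegaC_qEdges_subset`, `omegaCount_qEdges_le_credit` — **the exact
  credit lemma**: the `q`-edges of `F` form the family `K = qEdges q F` on `U \ q`; coloured by
  `c0 (s + q)` (the first colour of the `q`-member) and `c1 s` (the second colour of the `q`-free
  member), its whole `A`-family consists of `q`-edges of `A(F)` and its whole `C`-family of
  `q`-edges of `C(F)`: `Ω(U \ q, K; c0 ∘ insert q, c1) ≤ credit_q`;
* `card_le_omegaCount_of_step` — **the induction step**: if the oriented projection and the edge
  family both satisfy their (Ω)-bound, so does `F` (`|F| = |π_q F| + |K|`);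
* `conjOmega_of_base_of_goodPoint` — **(Ω) follows from its two-point base `OmegaBase` and the
  good-point property `OmegaGoodPoint`** (a point `q` and an orientation at which the credit pays
  the edges, with the projection's bound available), by induction on the ground set.

The credit lemma is where the twice-coloured language pays off: in the (Σ)-count the credit of a
consistent pair is one short when `{q}` is not in the family (Addendum 76); here the meets and
differences of `K` land in `A` and its co-joins in `C` with no loss, whatever the colours.
-/

namespace PercRepro.MSTight

open Finset

variable {α : Type*} [DecidableEq α]

section SetIdentities

variable {q : α} {s t U : Finset α}

/-- Two Booleans both different from a third are equal. -/
theorem bool_eq_of_ne_of_ne {x y z : Bool} (hx : x ≠ z) (hy : y ≠ z) : x = y := by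
  cases x <;> cases y <;> cases z <;> simp_all

/-- Inserting a point absent from `s` does not change the meet with `s`. -/
theorem inf_insert_of_notMem (hq : q ∉ s) (t : Finset α) : s ⊓ insert q t = s ⊓ t := by
  ext a
  simp only [inf_eq_inter, mem_inter, mem_insert]
  by_cases haq : a = q
  · subst haq; tauto
  · tauto

/-- Inserting the same point into both sets inserts it into the meet. -/
theorem insert_inf_insert (q : α) (s t : Finset α) :
    insert q s ⊓ insert q t = insert q (s ⊓ t) := by
  ext a
  simp only [inf_eq_inter, mem_inter, mem_insert]
  tauto

/-- Inserting a point absent from `s` into the subtrahend does not change `s \ t`. -/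
theorem sdiff_insert_of_notMem (hq : q ∉ s) (t : Finset α) : s \ insert q t = s \ t := by
  ext a
  simp only [mem_sdiff, mem_insert, not_or]
  by_cases haq : a = q
  · subst haq; tauto
  · tauto

/-- Inserting the same point into both sets does not change the difference when it is absent from the
first. -/
theorem insert_sdiff_insert_eq_sdiff (hq : q ∉ s) (t : Finset α) :
    insert q s \ insert q t = s \ t := by
  ext a
  simp only [mem_sdiff, mem_insert, not_or]
  by_cases haq : a = q
  · subst haq; tauto
  · tauto

/-- Inserting a point absent from the subtrahend inserts it into the difference. -/
theorem insert_sdiff_of_notMem' (hq : q ∉ t) (s : Finset α) :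
    insert q s \ t = insert q (s \ t) := by
  ext a
  simp only [mem_sdiff, mem_insert]
  by_cases haq : a = q
  · subst haq; tauto
  · tauto

/-- A relative co-join with a point inserted into the first set is the co-join relative to `U \ q`. -/
theorem sdiff_insert_sup_eq (q : α) (s t U : Finset α) :
    U \ (insert q s ⊔ t) = U.erase q \ (s ⊔ t) := by
  ext a
  simp only [mem_sdiff, sup_eq_union, mem_union, mem_insert, mem_erase, not_or]
  tauto

/-- A relative co-join with a point inserted into the second set is the co-join relative to `U \ q`. -/
theorem sdiff_sup_insert_eq (q : α) (s t U : Finset α) :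
    U \ (s ⊔ insert q t) = U.erase q \ (s ⊔ t) := by
  rw [sup_comm, sdiff_insert_sup_eq, sup_comm]

/-- A relative co-join with a point inserted into both sets is the co-join relative to `U \ q`. -/
theorem sdiff_insert_sup_insert_eq (q : α) (s t U : Finset α) :
    U \ (insert q s ⊔ insert q t) = U.erase q \ (s ⊔ t) := by
  ext a
  simp only [mem_sdiff, sup_eq_union, mem_union, mem_insert, mem_erase, not_or]
  tauto

/-- Putting the point back into a co-join relative to `U \ q` of two `q`-free sets gives the co-join
relative to `U`. -/
theorem insert_sdiff_erase_sup (hU : q ∈ U) (hq : q ∉ s) (ht : q ∉ t) :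
    insert q (U.erase q \ (s ⊔ t)) = U \ (s ⊔ t) := by
  ext a
  simp only [mem_insert, mem_sdiff, mem_erase, sup_eq_union, mem_union, not_or]
  by_cases haq : a = q
  · subst haq
    tauto
  · tauto

/-- Erasing a point distributes over the difference. -/
theorem sdiff_erase (x y : Finset α) (q : α) : (x \ y).erase q = x.erase q \ y.erase q := by
  ext a
  simp only [mem_erase, mem_sdiff, not_and]
  tauto

/-- Inserting a point is injective on the sets not containing it. -/
theorem insert_injective_of_notMem (hs : q ∉ s) (ht : q ∉ t) (h : insert q s = insert q t) :
    s = t := by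
  rw [← erase_insert hs, h, erase_insert ht]

end SetIdentities

section Orient

variable {q : α} {U : Finset α} {F : Finset (Finset α)} {c0 c1 o : Finset α → Bool}

/-- **The projection of a family at a point**: `{s \ q : s ∈ F}`. -/
def projFam (q : α) (F : Finset (Finset α)) : Finset (Finset α) := F.image fun s => s.erase q

/-- **The member chosen by an orientation**: the `q`-member `s + q` when `o s = true`, the `q`-free
member `s` otherwise. -/
def liftOrient (q : α) (o : Finset α → Bool) (s : Finset α) : Finset α :=
  if o s = true then insert q s else s

/-- **The colours of the oriented projection**: a projected set takes the colour of its chosen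
member. -/
def projColour (q : α) (o c : Finset α → Bool) : Finset α → Bool :=
  fun s => c (liftOrient q o s)

/-- **A valid orientation** only chooses members of `F`. -/
def ValidOrient (q : α) (F : Finset (Finset α)) (o : Finset α → Bool) : Prop :=
  ∀ s ∈ projFam q F, (o s = true → insert q s ∈ F) ∧ (o s = false → s ∈ F)

/-- Membership in the projection. -/
theorem mem_projFam {s : Finset α} : s ∈ projFam q F ↔ ∃ x ∈ F, x.erase q = s := by
  unfold projFam
  simp only [mem_image]

/-- Projected sets do not contain the point. -/
theorem notMem_of_mem_projFam {s : Finset α} (hs : s ∈ projFam q F) : q ∉ s := by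
  obtain ⟨x, -, rfl⟩ := mem_projFam.1 hs
  exact notMem_erase q x

/-- The member chosen by a valid orientation is a member of `F`. -/
theorem liftOrient_mem (ho : ValidOrient q F o) {s : Finset α} (hs : s ∈ projFam q F) :
    liftOrient q o s ∈ F := by
  unfold liftOrient
  by_cases h : o s = true
  · rw [if_pos h]
    exact (ho s hs).1 h
  · rw [if_neg h]
    exact (ho s hs).2 (by simpa using h)

/-- The chosen member projects back to the projected set. -/
theorem liftOrient_erase {s : Finset α} (hs : q ∉ s) : (liftOrient q o s).erase q = s := by
  unfold liftOrient
  by_cases h : o s = true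
  · rw [if_pos h, erase_insert hs]
  · rw [if_neg h, erase_eq_of_notMem hs]

/-- The `q`-free orientation (always choose the `q`-free member when it exists). -/
theorem validOrient_of_forall (h : ∀ s ∈ projFam q F, (o s = true → insert q s ∈ F) ∧
    (o s = false → s ∈ F)) : ValidOrient q F o := h

/-- **Lifting the `A`-family**: the `A`-family of the oriented projection lies inside the projected
`A`-family of `F`. -/
theorem omegaA_proj_subset (ho : ValidOrient q F o) :
    omegaA (projFam q F) (projColour q o c0) (projColour q o c1) ⊆
      (omegaA F c0 c1).image fun d => d.erase q := by
  intro E hE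
  rw [mem_image]
  rcases mem_omegaA.1 hE with ⟨s, hs, t, ht, hst, hc, rfl⟩ | ⟨s, hs, t, ht, hc, rfl⟩
  · have hqs := notMem_of_mem_projFam hs
    have hqt := notMem_of_mem_projFam ht
    refine ⟨liftOrient q o s ⊓ liftOrient q o t, ?_, ?_⟩
    · refine inf_mem_omegaA ?_ (liftOrient_mem ho hs) (liftOrient_mem ho ht) hc
      intro h
      exact hst (by rw [← liftOrient_erase (o := o) hqs, h, liftOrient_erase hqt])
    · rw [inf_erase, liftOrient_erase hqs, liftOrient_erase hqt]
  · have hqs := notMem_of_mem_projFam hs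
    have hqt := notMem_of_mem_projFam ht
    refine ⟨liftOrient q o s \ liftOrient q o t, ?_, ?_⟩
    · exact sdiff_mem_omegaA (liftOrient_mem ho hs) (liftOrient_mem ho ht) hc
    · rw [sdiff_erase, liftOrient_erase hqs, liftOrient_erase hqt]

/-- **Lifting the `C`-family**: the `C`-family of the oriented projection (relative to `U \ q`)
lies inside the projected `C`-family of `F`. -/
theorem omegaC_proj_subset (ho : ValidOrient q F o) :
    omegaC (U.erase q) (projFam q F) (projColour q o c1) ⊆
      (omegaC U F c1).image fun d => d.erase q := by
  intro E hE
  rw [mem_image]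
  obtain ⟨s, hs, t, ht, hst, hc, rfl⟩ := mem_omegaC.1 hE
  have hqs := notMem_of_mem_projFam hs
  have hqt := notMem_of_mem_projFam ht
  refine ⟨U \ (liftOrient q o s ⊔ liftOrient q o t), ?_, ?_⟩
  · refine sdiff_sup_mem_omegaC ?_ (liftOrient_mem ho hs) (liftOrient_mem ho ht) hc
    intro h
    exact hst (by rw [← liftOrient_erase (o := o) hqs, h, liftOrient_erase hqt])
  · rw [sdiff_sup_erase, liftOrient_erase hqs, liftOrient_erase hqt]

/-- **Lifting**: the (Ω)-count of the oriented projection plus the `q`-edges of the two families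
of `F` is at most the (Ω)-count of `F`. -/
theorem omegaCount_proj_add_le (ho : ValidOrient q F o) :
    omegaCount (U.erase q) (projFam q F) (projColour q o c0) (projColour q o c1) +
      ((qEdges q (omegaA F c0 c1)).card + (qEdges q (omegaC U F c1)).card) ≤
        omegaCount U F c0 c1 := by
  unfold omegaCount
  have h1 := card_eq_card_image_erase_add_card_qEdges q (omegaA F c0 c1)
  have h2 := card_eq_card_image_erase_add_card_qEdges q (omegaC U F c1)
  have hA := card_le_card (omegaA_proj_subset (c0 := c0) (c1 := c1) ho)
  have hC := card_le_card (omegaC_proj_subset (U := U) (c1 := c1) ho)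
  omega

end Orient

section Credit

variable {q : α} {U : Finset α} {F : Finset (Finset α)} {c0 c1 : Finset α → Bool}

/-- The first colour of the edge family: the first colour of the `q`-member. -/
def edgeC0 (q : α) (c0 : Finset α → Bool) : Finset α → Bool := fun s => c0 (insert q s)

/-- Members of the edge family are `q`-free members of `F` whose `q`-neighbour is a member. -/
theorem mem_qEdges' {s : Finset α} (hs : s ∈ qEdges q F) :
    s ∈ F ∧ q ∉ s ∧ insert q s ∈ F := mem_qEdges.1 hs

/-- **The credit lemma, `A`-side**: every member of the `A`-family of the edge family `K`
(coloured by `c0 ∘ insert q` and `c1`) is a `q`-edge of the `A`-family of `F`. -/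
theorem omegaA_qEdges_subset :
    omegaA (qEdges q F) (edgeC0 q c0) c1 ⊆ qEdges q (omegaA F c0 c1) := by
  intro E hE
  rw [mem_qEdges]
  rcases mem_omegaA.1 hE with ⟨s, hs, t, ht, hst, hc, rfl⟩ | ⟨s, hs, t, ht, hc, rfl⟩
  · -- a meet `s ⊓ t` with `c0 (s + q) = c0 (t + q)`
    obtain ⟨hsF, hqs, hsqF⟩ := mem_qEdges' hs
    obtain ⟨htF, hqt, htqF⟩ := mem_qEdges' ht
    simp only [edgeC0] at hc
    have hsq_ne_t : insert q s ≠ t := fun h => hqt (h ▸ mem_insert_self q s)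
    have hs_ne_tq : s ≠ insert q t := fun h => hqs (h ▸ mem_insert_self q t)
    have hsq_ne_tq : insert q s ≠ insert q t := fun h => hst (insert_injective_of_notMem hqs hqt h)
    refine ⟨?_, ?_, ?_⟩
    · by_cases h1 : c0 s = c0 (insert q s)
      · have := inf_mem_omegaA (c1 := c1) hs_ne_tq hsF htqF (h1.trans hc)
        rwa [inf_insert_of_notMem hqs] at this
      · by_cases h2 : c0 t = c0 (insert q t)
        · have := inf_mem_omegaA (c1 := c1) hsq_ne_t hsqF htF (hc.trans h2.symm)
          rwa [inf_comm, inf_insert_of_notMem hqt, inf_comm] at this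
        · exact inf_mem_omegaA hst hsF htF (bool_eq_of_ne_of_ne h1 (hc ▸ h2))
    · simp only [inf_eq_inter, mem_inter, not_and]
      exact fun h => absurd h hqs
    · rw [← insert_inf_insert]
      exact inf_mem_omegaA hsq_ne_tq hsqF htqF hc
  · -- a difference `s \ t` with `c0 (s + q) = c1 t`
    obtain ⟨hsF, hqs, hsqF⟩ := mem_qEdges' hs
    obtain ⟨htF, hqt, htqF⟩ := mem_qEdges' ht
    simp only [edgeC0] at hc
    refine ⟨?_, ?_, ?_⟩
    · by_cases h1 : c0 s = c1 t
      · exact sdiff_mem_omegaA hsF htF h1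
      · by_cases h2 : c1 (insert q t) = c1 t
        · have := sdiff_mem_omegaA (c0 := c0) hsqF htqF (hc.trans h2.symm)
          rwa [insert_sdiff_insert_eq_sdiff hqs] at this
        · have := sdiff_mem_omegaA (c0 := c0) hsF htqF (bool_eq_of_ne_of_ne h1 h2)
          rwa [sdiff_insert_of_notMem hqs] at this
    · simp only [mem_sdiff, not_and]
      exact fun h => absurd h hqs
    · rw [← insert_sdiff_of_notMem' hqt]
      exact sdiff_mem_omegaA hsqF htF hc

/-- **The credit lemma, `C`-side**: every member of the `C`-family of the edge family `K`
(relative to `U \ q`) is a `q`-edge of the `C`-family of `F`. -/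
theorem omegaC_qEdges_subset (hq : q ∈ U) :
    omegaC (U.erase q) (qEdges q F) c1 ⊆ qEdges q (omegaC U F c1) := by
  intro E hE
  rw [mem_qEdges]
  obtain ⟨s, hs, t, ht, hst, hc, rfl⟩ := mem_omegaC.1 hE
  obtain ⟨hsF, hqs, hsqF⟩ := mem_qEdges' hs
  obtain ⟨htF, hqt, htqF⟩ := mem_qEdges' ht
  have hsq_ne_t : insert q s ≠ t := fun h => hqt (h ▸ mem_insert_self q s)
  have hs_ne_tq : s ≠ insert q t := fun h => hqs (h ▸ mem_insert_self q t)
  have hsq_ne_tq : insert q s ≠ insert q t := fun h => hst (insert_injective_of_notMem hqs hqt h)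
  refine ⟨?_, ?_, ?_⟩
  · by_cases h1 : c1 (insert q s) = c1 s
    · have := sdiff_sup_mem_omegaC (U := U) hsq_ne_t hsqF htF (h1.trans hc)
      rwa [sdiff_insert_sup_eq] at this
    · by_cases h2 : c1 (insert q t) = c1 t
      · have := sdiff_sup_mem_omegaC (U := U) hs_ne_tq hsF htqF (hc.trans h2.symm)
        rwa [sdiff_sup_insert_eq] at this
      · have h3 : c1 (insert q s) = c1 (insert q t) :=
          bool_eq_of_ne_of_ne h1 (hc ▸ h2)
        have := sdiff_sup_mem_omegaC (U := U) hsq_ne_tq hsqF htqF h3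
        rwa [sdiff_insert_sup_insert_eq] at this
  · simp only [mem_sdiff, mem_erase, ne_eq, not_true_eq_false, false_and, not_false_eq_true]
  · rw [insert_sdiff_erase_sup hq hqs hqt]
    exact sdiff_sup_mem_omegaC hst hsF htF hc

/-- **The exact credit lemma**: the (Ω)-count of the edge family, coloured by `c0 ∘ insert q` and
`c1`, is at most the number of `q`-edges of the two families of `F`. -/
theorem omegaCount_qEdges_le_credit (hq : q ∈ U) :
    omegaCount (U.erase q) (qEdges q F) (edgeC0 q c0) c1 ≤
      (qEdges q (omegaA F c0 c1)).card + (qEdges q (omegaC U F c1)).card := by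
  unfold omegaCount
  have hA := card_le_card (omegaA_qEdges_subset (q := q) (F := F) (c0 := c0) (c1 := c1))
  have hC := card_le_card (omegaC_qEdges_subset (F := F) (c1 := c1) hq)
  omega

/-- **The induction step**: if the oriented projection and the edge family both satisfy their
(Ω)-bound, so does `F`. -/
theorem card_le_omegaCount_of_step {o : Finset α → Bool} (hq : q ∈ U) (ho : ValidOrient q F o)
    (hP : (projFam q F).card ≤
      omegaCount (U.erase q) (projFam q F) (projColour q o c0) (projColour q o c1))
    (hK : (qEdges q F).card ≤ omegaCount (U.erase q) (qEdges q F) (edgeC0 q c0) c1) :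
    F.card ≤ omegaCount U F c0 c1 := by
  have hsplit : F.card = (projFam q F).card + (qEdges q F).card :=
    card_eq_card_image_erase_add_card_qEdges q F
  have hlift := omegaCount_proj_add_le (U := U) (c0 := c0) (c1 := c1) ho
  have hcred := omegaCount_qEdges_le_credit (F := F) (c0 := c0) (c1 := c1) hq
  omega

end Credit

section GoodPoint

/-- **The two-point base of (Ω)**: the bound on ground sets with at most two points. -/
def OmegaBase (α : Type*) [DecidableEq α] : Prop :=
  ∀ (U : Finset α) (F : Finset (Finset α)) (c0 c1 : Finset α → Bool),
    U.card ≤ 2 → (∀ s ∈ F, s ⊆ U) → 3 ≤ F.card → F.card ≤ omegaCount U F c0 c1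

/-- **The good-point property**: on a ground set with at least three points, every family with at
least three members has a point `q` and a valid orientation at which the credit pays the edges —
either the projection keeps at least three members (so its bound is available by induction) and
`|π_q F| + credit ≥ |F|`, or it has at most two and its actual (Ω)-count plus the credit is at
least `|F|`. Numerically true on every family of 3 points and on 4 points for `|F| ≤ 6`
(Addendum 80). -/
def OmegaGoodPoint (α : Type*) [DecidableEq α] : Prop :=
  ∀ (U : Finset α) (F : Finset (Finset α)) (c0 c1 : Finset α → Bool),
    3 ≤ U.card → (∀ s ∈ F, s ⊆ U) → 3 ≤ F.card →
      ∃ q ∈ U, ∃ o : Finset α → Bool, ValidOrient q F o ∧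
        ((3 ≤ (projFam q F).card ∧
            (projFam q F).card +
              ((qEdges q (omegaA F c0 c1)).card + (qEdges q (omegaC U F c1)).card) ≥ F.card) ∨
          ((projFam q F).card ≤ 2 ∧
            omegaCount (U.erase q) (projFam q F) (projColour q o c0) (projColour q o c1) +
              ((qEdges q (omegaA F c0 c1)).card + (qEdges q (omegaC U F c1)).card) ≥ F.card))

/-- **(Ω) follows from its base and the good-point property**, by strong induction on the ground
set. -/
theorem conjOmega_of_base_of_goodPoint (hb : OmegaBase α) (hg : OmegaGoodPoint α) :
    ConjOmega α := by
  intro U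
  induction U using Finset.strongInduction with
  | H U ih =>
    intro F c0 c1 hF h3
    by_cases hU : U.card ≤ 2
    · exact hb U F c0 c1 hU hF h3
    · obtain ⟨q, hq, o, ho, hgood⟩ := hg U F c0 c1 (by omega) hF h3
      have hlift := omegaCount_proj_add_le (U := U) (c0 := c0) (c1 := c1) ho
      have hsplit : F.card = (projFam q F).card + (qEdges q F).card :=
        card_eq_card_image_erase_add_card_qEdges q F
      have hsub : ∀ s ∈ projFam q F, s ⊆ U.erase q := by
        intro s hs
        obtain ⟨x, hx, rfl⟩ := mem_projFam.1 hs
        intro a ha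
        rw [mem_erase] at ha ⊢
        exact ⟨ha.1, hF x hx ha.2⟩
      rcases hgood with ⟨hP3, hP⟩ | ⟨-, hP⟩
      · have hih := ih (U.erase q) (erase_ssubset hq) (projFam q F) (projColour q o c0)
          (projColour q o c1) hsub hP3
        omega
      · omega

end GoodPoint

end PercRepro.MSTight
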